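import Summits.PneNP.PneNP.Theorems.SoloInformedIOShape
import Literature.Computability.Complexity.CookReducibilityTransitive
import Literature.Computability.Complexity.BranchingFn
import Literature.Computability.Complexity.NondeterministicProofs
import HarnessLib

/-!
# Solo (informed) — the structural face of the summit: the Berman–Hartmanis isomorphism
# conjecture reaches `P ≠ NP` only through "no NP-complete set is finite"

Generation 15 margin for `paper/sharpest-statement.md` §2 F20 / §4 R27 (Post's programme:
structural properties of complete sets).

Berman and Hartmanis (1977) conjectured that all NP-complete sets are pairwise polynomial-time
isomorphic (`SoloIso.BermanHartmanis`, tagged `@[conjecture]`: an open conjecture stated in our theories), and observed that the conjecture implies `P ≠ NP`. This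
file types that implication and isolates exactly how much of it is the summit:

* `SoloIso.PIso L₁ L₂` — a p-isomorphism as data: a bijection `f` of `{0,1}*` with `f, f⁻¹ ∈ FP` and
  `x ∈ L₁ ↔ f x ∈ L₂` (`PIso.refl/symm/trans/karpReducible`; p-isomorphic = `Nonempty (PIso L₁ L₂)`).
* `soloInformed_karpReducible_of_mem_P` — every `L' ∈ P` Karp-reduces to every language with a
  member and a non-member; hence under `NP ⊆ P` every such language is NP-hard
  (`soloInformed_isNPHard_of_NP_subset_P`), and if `¬ PneNP` every singleton `{c}` and every
  co-singleton `{c}ᶜ` is NP-complete (`soloInformed_isNPComplete_singleton_of_not_pneNP`,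
  `soloInformed_isNPComplete_compl_singleton_of_not_pneNP`).
* **`soloInformed_pneNP_iff_forall_isNPComplete_infinite : PneNP ↔ every NP-complete set is
  infinite`** and `soloInformed_pneNP_iff_forall_isNPComplete_coinfinite : PneNP ↔ every NP-complete
  set is co-infinite` — the whole content of the summit that the isomorphism conjecture uses.
* `soloInformed_not_pIsomorphic_of_finite_of_infinite` — a finite and an infinite language are not
  p-isomorphic (the inverse map would inject the infinite one into the finite one); whence
  **`soloInformed_pneNP_of_bermanHartmanis : SoloIso.BermanHartmanis → PneNP`** (under `¬ PneNP` the
  NP-complete sets `{[]}` and `{[]}ᶜ` would be p-isomorphic) and the factorisation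
  `soloInformed_bermanHartmanis_iff : BermanHartmanis ↔ PneNP ∧ (pairwise p-isomorphism of the
  NP-complete sets)` — i.e. the conjecture is the summit PLUS a density/padding rider, and the rider
  is where all its structural content (Berman–Hartmanis: `L ≅ₚ SAT` iff `L` is NP-complete and a
  p-cylinder; Kurtz–Mahaney–Royer: fails relative to a random oracle; Agrawal, Agrawal–Watanabe:
  holds non-uniformly under one-way-function hypotheses) lives. As a door to the summit it is shut
  by construction: one must prove `P ≠ NP` inside it.

References: L. Berman, J. Hartmanis, *On isomorphisms and density of NP and other complete sets*,
SIAM J. Comput. 6 (1977) 305–322, Thm. p. 313 and the remark that the conjecture implies P ≠ NP;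
S. Kurtz, S. Mahaney, J. Royer, *The isomorphism conjecture fails relative to a random oracle*,
J. ACM 42 (1995); M. Agrawal, *The isomorphism conjecture for NP*, in: Computability in Context
(2011), §§3–6. All ingredients are tree theorems (`condFn_mem_FP`, `const_mem_FP`,
`mem_P_of_finite`, `NP_subset_P_of_isNPComplete_of_mem_P`, `P_subset_NP_holds`); standard axioms only.
-/

namespace Summit.PneNP.PneNP.Theorems

open Literature.Computability.Complexity
open Literature.Computability.Complexity.OracleCompose (condFn condFn_mem_FP condFn_of_mem condFn_of_not_mem)
open scoped Literature.Computability.Complexity.Notation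

namespace SoloIso

/-- **A polynomial-time isomorphism** between languages over `{0,1}` (Berman–Hartmanis 1977, §2),
as DATA: maps `toFun, invFun ∈ FP`, mutually inverse on all of `{0,1}*`, with
`x ∈ L₁ ↔ toFun x ∈ L₂`. `L₁` and `L₂` are *p-isomorphic* iff `Nonempty (PIso L₁ L₂)`.
[cite: BermanHartmanis1977, §2] -/
structure PIso (L₁ L₂ : Language Bool) where
  /-- the forward map -/
  toFun : List Bool → List Bool
  /-- the inverse map -/
  invFun : List Bool → List Bool
  toFun_mem_FP : toFun ∈ FP
  invFun_mem_FP : invFun ∈ FP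
  left_inv : ∀ x, invFun (toFun x) = x
  right_inv : ∀ y, toFun (invFun y) = y
  mem_iff : ∀ x, x ∈ L₁ ↔ toFun x ∈ L₂

/-- **The Berman–Hartmanis isomorphism conjecture** (1977): all NP-complete sets (under Karp
reductions) are pairwise p-isomorphic. An OPEN conjecture stated in our theories (tagged
`@[conjecture]`); this file proves only `BermanHartmanis → PneNP` and the factorisation below.
[cite: BermanHartmanis1977, §1 Conjecture] -/
@[conjecture] def BermanHartmanis : Prop :=
  ∀ L₁ L₂ : Language Bool, IsNPComplete L₁ → IsNPComplete L₂ → Nonempty (PIso L₁ L₂)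

/-- The identity p-isomorphism. -/
protected def PIso.refl (L : Language Bool) : PIso L L :=
  ⟨id, id, PolyTimeComputable.id _, PolyTimeComputable.id _, fun _ => rfl, fun _ => rfl,
    fun _ => Iff.rfl⟩

/-- The inverse p-isomorphism (swap the two maps). -/
protected def PIso.symm {L₁ L₂ : Language Bool} (h : PIso L₁ L₂) : PIso L₂ L₁ :=
  ⟨h.invFun, h.toFun, h.invFun_mem_FP, h.toFun_mem_FP, h.right_inv, h.left_inv, fun y => by
    have := h.mem_iff (h.invFun y)
    rw [h.right_inv] at this
    exact this.symm⟩

/-- Composition of p-isomorphisms (`FP` is closed under composition, `comp_mem_FP`). -/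
protected def PIso.trans {L₁ L₂ L₃ : Language Bool} (h : PIso L₁ L₂) (h' : PIso L₂ L₃) :
    PIso L₁ L₃ :=
  ⟨h'.toFun ∘ h.toFun, h.invFun ∘ h'.invFun, comp_mem_FP h'.toFun_mem_FP h.toFun_mem_FP,
    comp_mem_FP h.invFun_mem_FP h'.invFun_mem_FP,
    fun x => by simp [h'.left_inv, h.left_inv], fun y => by simp [h.right_inv, h'.right_inv],
    fun x => (h.mem_iff x).trans (h'.mem_iff (h.toFun x))⟩

/-- A p-isomorphism is in particular a Karp reduction each way. -/
theorem PIso.karpReducible {L₁ L₂ : Language Bool} (h : PIso L₁ L₂) : L₁ ≤ₚ L₂ ∧ L₂ ≤ₚ L₁ :=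
  ⟨polyTimeKarpReducible_iff.mpr ⟨h.toFun, h.toFun_mem_FP, h.mem_iff⟩,
    polyTimeKarpReducible_iff.mpr ⟨h.symm.toFun, h.symm.toFun_mem_FP, h.symm.mem_iff⟩⟩

end SoloIso

open SoloIso

/-- **Every language in `P` Karp-reduces to every language with a member and a non-member**:
map `x ↦ w₀` if `x ∈ L'`, else `x ↦ w₁` (the `P`-guarded conditional of two constant maps is in
`FP`). [Arora–Barak 2009, Ex. 2.30 (b); Berman–Hartmanis 1977, p. 306] -/
theorem soloInformed_karpReducible_of_mem_P {L' L : Language Bool} (hL' : L' ∈ Classes.P)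
    {w₀ w₁ : List Bool} (h₀ : w₀ ∈ L) (h₁ : w₁ ∉ L) : L' ≤ₚ L := by
  refine polyTimeKarpReducible_iff.mpr ⟨condFn L' (fun _ => w₀) (fun _ => w₁),
    condFn_mem_FP hL' (const_mem_FP w₀) (const_mem_FP w₁), fun x => ?_⟩
  by_cases hx : x ∈ L'
  · rw [condFn_of_mem _ _ hx]
    exact ⟨fun _ => h₀, fun _ => hx⟩
  · rw [condFn_of_not_mem _ _ hx]
    exact ⟨fun h => absurd h hx, fun h => absurd h h₁⟩

/-- Under `NP ⊆ P` every language with a member and a non-member is NP-hard. -/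
theorem soloInformed_isNPHard_of_NP_subset_P (hNP : Nondeterministic.NP ⊆ Classes.P)
    {L : Language Bool} {w₀ w₁ : List Bool} (h₀ : w₀ ∈ L) (h₁ : w₁ ∉ L) : IsNPHard L :=
  fun _ hL' => soloInformed_karpReducible_of_mem_P (hNP hL') h₀ h₁

/-- `PneNP ↔ ¬ NP ⊆ P` (from the prelude-class form `soloInformed_pneNP_iff_exists_not_mem`). -/
theorem soloInformed_pneNP_iff_not_NP_subset_P' : PneNP ↔ ¬ Nondeterministic.NP ⊆ Classes.P := by
  rw [soloInformed_pneNP_iff_exists_not_mem, Set.not_subset]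

/-- **If `P = NP`, every singleton is NP-complete.** -/
theorem soloInformed_isNPComplete_singleton_of_not_pneNP (h : ¬ PneNP) (c : List Bool) :
    IsNPComplete ({c} : Language Bool) := by
  have hNP : Nondeterministic.NP ⊆ Classes.P := by
    by_contra hc; exact h (soloInformed_pneNP_iff_not_NP_subset_P'.mpr hc)
  have hP : ({c} : Language Bool) ∈ Classes.P := Literature.Barriers.PneNP.singleton_mem_P c
  refine ⟨P_subset_NP_holds hP, soloInformed_isNPHard_of_NP_subset_P hNP (w₀ := c) (w₁ := true :: c)
    rfl ?_⟩
  show ¬ (true :: c = c)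
  exact fun e => by simpa using congrArg List.length e

/-- **If `P = NP`, every co-singleton is NP-complete.** -/
theorem soloInformed_isNPComplete_compl_singleton_of_not_pneNP (h : ¬ PneNP) (c : List Bool) :
    IsNPComplete ({c}ᶜ : Language Bool) := by
  have hNP : Nondeterministic.NP ⊆ Classes.P := by
    by_contra hc; exact h (soloInformed_pneNP_iff_not_NP_subset_P'.mpr hc)
  have hP : ({c}ᶜ : Language Bool) ∈ Classes.P :=
    compl_mem_P_iff.mpr (Literature.Barriers.PneNP.singleton_mem_P c)
  refine ⟨P_subset_NP_holds hP,
    soloInformed_isNPHard_of_NP_subset_P hNP (w₀ := true :: c) (w₁ := c) ?_ ?_⟩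
  · show ¬ (true :: c) ∈ ({c} : Language Bool)
    intro e
    have e' : true :: c = c := e
    simpa using congrArg List.length e'
  · show ¬ ¬ c ∈ ({c} : Language Bool)
    exact not_not.mpr rfl

/-- **`P ≠ NP` iff every NP-complete set is infinite.** (→) a finite language is in `P`
(`mem_P_of_finite`), and an NP-complete language in `P` gives `NP ⊆ P`; (←) under `P = NP` the
singleton `{[]}` is a finite NP-complete set. [Berman–Hartmanis 1977, p. 306] -/
theorem soloInformed_pneNP_iff_forall_isNPComplete_infinite :
    PneNP ↔ ∀ L : Language Bool, IsNPComplete L → (L : Set (List Bool)).Infinite := by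
  constructor
  · intro h L hL
    by_contra hfin
    rw [Set.not_infinite] at hfin
    exact soloInformed_pneNP_iff_not_NP_subset_P'.mp h
      (NP_subset_P_of_isNPComplete_of_mem_P hL (Literature.Barriers.PneNP.mem_P_of_finite hfin))
  · intro h
    by_contra hne
    exact h _ (soloInformed_isNPComplete_singleton_of_not_pneNP hne [])
      (Set.finite_singleton ([] : List Bool))

/-- **`P ≠ NP` iff every NP-complete set is co-infinite.** -/
theorem soloInformed_pneNP_iff_forall_isNPComplete_coinfinite :
    PneNP ↔ ∀ L : Language Bool, IsNPComplete L → ((Lᶜ : Language Bool) : Set (List Bool)).Infinite := by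
  constructor
  · intro h L hL
    by_contra hfin
    rw [Set.not_infinite] at hfin
    have hc : (Lᶜ : Language Bool) ∈ Classes.P := Literature.Barriers.PneNP.mem_P_of_finite hfin
    exact soloInformed_pneNP_iff_not_NP_subset_P'.mp h
      (NP_subset_P_of_isNPComplete_of_mem_P hL (compl_mem_P_iff.mp hc))
  · intro h
    by_contra hne
    have := h _ (soloInformed_isNPComplete_compl_singleton_of_not_pneNP hne [])
    rw [compl_compl] at this
    exact this (Set.finite_singleton ([] : List Bool))

/-- **A finite and an infinite language are never p-isomorphic**: the inverse map `g` of an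
isomorphism sends `L₂` injectively into `L₁`. (No complexity is used — only bijectivity.) -/
theorem soloInformed_not_pIsomorphic_of_finite_of_infinite {L₁ L₂ : Language Bool}
    (h₁ : (L₁ : Set (List Bool)).Finite) (h₂ : (L₂ : Set (List Bool)).Infinite) :
    IsEmpty (PIso L₁ L₂) := by
  refine ⟨fun e => ?_⟩
  obtain ⟨f, g, -, -, -, hfg, hmem⟩ := e
  have hmaps : Set.MapsTo g (L₂ : Set (List Bool)) (L₁ : Set (List Bool)) := by
    intro y hy
    have : f (g y) ∈ L₂ := by rw [hfg]; exact hy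
    exact (hmem (g y)).mpr this
  have hinj : Set.InjOn g (L₂ : Set (List Bool)) := by
    intro y₁ _ y₂ _ e
    have := congrArg f e
    rwa [hfg, hfg] at this
  exact h₂ (Set.Finite.of_injOn hmaps hinj h₁)

/-- **The isomorphism conjecture implies `P ≠ NP`** (Berman–Hartmanis 1977): if `P = NP` then the
finite set `{[]}` and the infinite set `{[]}ᶜ` are both NP-complete, and they are not
p-isomorphic. [cite: BermanHartmanis1977, §1] -/
theorem soloInformed_pneNP_of_bermanHartmanis (h : BermanHartmanis) : PneNP := by
  by_contra hne
  have hfin : (({[]} : Language Bool) : Set (List Bool)).Finite := Set.finite_singleton _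
  have hinf : (({[]}ᶜ : Language Bool) : Set (List Bool)).Infinite := by
    -- the words `1^{n+1}` are pairwise distinct members of `{[]}ᶜ`
    refine Set.infinite_of_injective_forall_mem (f := fun n : ℕ => List.replicate (n + 1) true)
      (fun m n e => by simpa using congrArg List.length e) fun n => ?_
    show ¬ (List.replicate (n + 1) true = ([] : List Bool))
    simp
  obtain ⟨e⟩ := h _ _ (soloInformed_isNPComplete_singleton_of_not_pneNP hne [])
    (soloInformed_isNPComplete_compl_singleton_of_not_pneNP hne [])
  exact (soloInformed_not_pIsomorphic_of_finite_of_infinite hfin hinf).false e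

/-- **Factorisation**: the isomorphism conjecture is EXACTLY `P ≠ NP` plus the structural rider
"the NP-complete sets are pairwise p-isomorphic" — the rider being vacuous-or-not independently of
how the summit is proved. As a door to the summit the conjecture is therefore closed by
construction: its only use of `P ≠ NP`-strength is `soloInformed_pneNP_iff_forall_isNPComplete_infinite`. -/
theorem soloInformed_bermanHartmanis_iff :
    BermanHartmanis ↔ PneNP ∧ ∀ L₁ L₂ : Language Bool, IsNPComplete L₁ → IsNPComplete L₂ →
      Nonempty (PIso L₁ L₂) :=
  ⟨fun h => ⟨soloInformed_pneNP_of_bermanHartmanis h, h⟩, fun h => h.2⟩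

end Summit.PneNP.PneNP.Theorems
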